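import Summits.CriticalPhenomena.SAWScalingLimit.Theorems.SAWTotalPositivityBoundaryTP2Strip4PairSym
import HarnessLib

/-!
# Crux `BoundaryTP2` (stmt-CriticalPhenomena-7115), line `Sketch`: the kernel table of the 4-row strip (lead c6)

Elementary symmetry bookkeeping for the width-4 assembly files: the diagonal and vertical reflections of the strip
kernels, the table of the sixteen kernels `Z((0,r),(n,s))` in the six letters `a,b,c,d = Z((0,0),(n,0..3))`,
`e,f = Z((0,1),(n,1..2))`, right ends = left ends, monotonicity of the strips in the length, and the passage from a
real inequality of products of finite kernels to the `ℝ≥0∞` one. [folklore]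
-/

noncomputable section

namespace Summit.CriticalPhenomena.SAWScalingLimit.Theorems.BoundaryTP2

open Literature.Probability.LatticeModels Literature.Probability.RandomPlanarGeometry
open Summit.CriticalPhenomena.SAWScalingLimit.Theorems.EdgeOfPositivity.Negative
open scoped ENNReal

/-- Diagonal symmetry of the strip kernels: `Z((0,r),(n,s)) = Z((0,s),(n,r))`. [folklore] -/
theorem strip4_diag (n : ℕ) (x : ℝ) (r s : ℤ) :
    pathKernel (discreteDomainGraph (rectDomain n 3) 1) x (st 0 r) (st n s) =
      pathKernel (discreteDomainGraph (rectDomain n 3) 1) x (st 0 s) (st n r) := by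
  rw [(stub_rect_reflect n 3 x 0 r n s).1, sub_zero, sub_self, pathKernel_comm]

/-- Vertical symmetry of the strip kernels: `Z((0,r),(n,s)) = Z((0,3-r),(n,3-s))`. [folklore] -/
theorem strip4_vert (n : ℕ) (x : ℝ) (r s : ℤ) :
    pathKernel (discreteDomainGraph (rectDomain n 3) 1) x (st 0 r) (st n s) =
      pathKernel (discreteDomainGraph (rectDomain n 3) 1) x (st 0 (3 - r)) (st n (3 - s)) := by
  rw [(stub_rect_reflect n 3 x 0 r n s).2]; norm_num

/-- **The kernel table**: the sixteen kernels `Z((0,r),(n,s))` in the six letters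
`a,b,c,d = Z((0,0),(n,0..3))`, `e,f = Z((0,1),(n,1..2))`. [folklore] -/
theorem strip4_table (n : ℕ) (x : ℝ) :
    pathKernel (discreteDomainGraph (rectDomain n 3) 1) x (st 0 1) (st n 0) =
        pathKernel (discreteDomainGraph (rectDomain n 3) 1) x (st 0 0) (st n 1) ∧
    pathKernel (discreteDomainGraph (rectDomain n 3) 1) x (st 0 2) (st n 0) =
        pathKernel (discreteDomainGraph (rectDomain n 3) 1) x (st 0 0) (st n 2) ∧
    pathKernel (discreteDomainGraph (rectDomain n 3) 1) x (st 0 3) (st n 0) =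
        pathKernel (discreteDomainGraph (rectDomain n 3) 1) x (st 0 0) (st n 3) ∧
    pathKernel (discreteDomainGraph (rectDomain n 3) 1) x (st 0 1) (st n 3) =
        pathKernel (discreteDomainGraph (rectDomain n 3) 1) x (st 0 0) (st n 2) ∧
    pathKernel (discreteDomainGraph (rectDomain n 3) 1) x (st 0 2) (st n 1) =
        pathKernel (discreteDomainGraph (rectDomain n 3) 1) x (st 0 1) (st n 2) ∧
    pathKernel (discreteDomainGraph (rectDomain n 3) 1) x (st 0 2) (st n 2) =
        pathKernel (discreteDomainGraph (rectDomain n 3) 1) x (st 0 1) (st n 1) ∧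
    pathKernel (discreteDomainGraph (rectDomain n 3) 1) x (st 0 2) (st n 3) =
        pathKernel (discreteDomainGraph (rectDomain n 3) 1) x (st 0 0) (st n 1) ∧
    pathKernel (discreteDomainGraph (rectDomain n 3) 1) x (st 0 3) (st n 1) =
        pathKernel (discreteDomainGraph (rectDomain n 3) 1) x (st 0 0) (st n 2) ∧
    pathKernel (discreteDomainGraph (rectDomain n 3) 1) x (st 0 3) (st n 2) =
        pathKernel (discreteDomainGraph (rectDomain n 3) 1) x (st 0 0) (st n 1) ∧
    pathKernel (discreteDomainGraph (rectDomain n 3) 1) x (st 0 3) (st n 3) =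
        pathKernel (discreteDomainGraph (rectDomain n 3) 1) x (st 0 0) (st n 0) := by
  have D := strip4_diag n x
  have V := strip4_vert n x
  refine ⟨D 1 0, D 2 0, ?_, ?_, ?_, ?_, ?_, ?_, ?_, ?_⟩
  · rw [V 3 0]; norm_num
  · rw [V 1 3]; norm_num; exact D 2 0
  · rw [V 2 1]; norm_num
  · rw [V 2 2]; norm_num
  · rw [V 2 3]; norm_num; exact D 1 0
  · rw [V 3 1]; norm_num
  · rw [V 3 2]; norm_num
  · rw [V 3 3]; norm_num

/-- The strips are increasing in the length as graphs. [folklore] -/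
theorem strip4_graph_mono {m n : ℕ} (h : m ≤ n) :
    discreteDomainGraph (rectDomain m 3) 1 ≤ discreteDomainGraph (rectDomain n 3) 1 := by
  intro u v huv
  rw [adj_rect_iff] at huv ⊢
  obtain ⟨h1, hu, hv⟩ := huv
  rw [mem_rectSites_iff] at hu hv
  refine ⟨h1, ?_, ?_⟩ <;> rw [mem_rectSites_iff] <;> omega

/-- The right-end kernels equal the left-end ones (horizontal reflection). [folklore] -/
theorem strip4_rightEnd (n : ℕ) (x : ℝ) (j k : ℤ) :
    pathKernel (discreteDomainGraph (rectDomain n 3) 1) x (st n j) (st n k) = pathKernel (discreteDomainGraph (rectDomain n 3) 1) x (st 0 j) (st 0 k) := by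
  rw [(stub_rect_reflect n 3 x n j n k).1, sub_self]

/-- Vertical reflection of the left-end kernels. [folklore] -/
theorem strip4_vert0 (n : ℕ) (x : ℝ) (j k : ℤ) :
    pathKernel (discreteDomainGraph (rectDomain n 3) 1) x (st 0 j) (st 0 k) = pathKernel (discreteDomainGraph (rectDomain n 3) 1) x (st 0 (3 - j)) (st 0 (3 - k)) := by
  rw [(stub_rect_reflect n 3 x 0 j 0 k).2]; norm_num

/-- From a real inequality of products of finite kernels to the `ℝ≥0∞` one. [folklore] -/
theorem s4tp_mul_le {A B C D : ℝ≥0∞} (hA : A ≠ ∞) (hB : B ≠ ∞) (hC : C ≠ ∞) (hD : D ≠ ∞)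
    (h : A.toReal * B.toReal ≤ C.toReal * D.toReal) : A * B ≤ C * D := by
  rw [← ENNReal.toReal_mul, ← ENNReal.toReal_mul] at h
  exact (ENNReal.toReal_le_toReal (ENNReal.mul_ne_top hA hB) (ENNReal.mul_ne_top hC hD)).1 h

end Summit.CriticalPhenomena.SAWScalingLimit.Theorems.BoundaryTP2
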